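import Literature.AlgebraicGeometry.Deformation.MorphismLiftsSquareZeroCechLift
import Literature.AlgebraicGeometry.Deformation.MorphismLiftsSquareZeroSmoothAffine
import Literature.AlgebraicGeometry.AbelianSchemes.AbelianSchemeLiftRigidity
import Literature.AlgebraicGeometry.AbelianSchemes.AbelianSchemeOverGeometricallyIntegral
import Literature.AlgebraicGeometry.AbelianSchemes.AbelianSchemeRelDimOfConnected
import Literature.AlgebraicGeometry.GroupSchemes.CotangentSheafFreeOverLocalRing
import Literature.AlgebraicGeometry.Motives.KunnethH1FibreRingRestrictBase
import HarnessLib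

/-!
# The group law of an abelian scheme lifts, as a morphism, to every smooth proper deformation over a square-zero
# thickening of an Artin local base ([MFK94] Prop. 6.15, first half; [SGA1] III 5.1; Künneth)

Layer `Literature/AlgebraicGeometry/AbelianSchemes` (cell hodgecm-mathlib, F-4 `stub_IIaE` ∕ F-11 (A4b): FILE A = (E) of
[MumfordFogartyKirwan1994] Prop. 6.15; `B-provers/B-p01/g16/SOCKETS-A4b-FileA-E.v0`).  THEOREMS ONLY.

THE STATEMENT (B-p04 (g22)'s (E) letter, verbatim): for an Artin local ring `A`, a proper ideal `J` with `𝔪·J = 0`, a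
smooth proper `X → Spec A` and an abelian scheme `A₀` over `Spec (A⧸J)` with a cartesian square `G : A₀.X → X` over
`Spec (A⧸J) → Spec A`, the law `μ₀ : A₀.X × A₀.X → A₀.X` LIFTS to a morphism `m : X ×_A X → X`
(`exists_mul_lift_of_isPullback_specMap_mk`).  With B-p04's (G) `AbelianSchemeOfLiftedGroupLaw` («any lift is a group law»)
this is Prop. 6.15.

THE PROOF (print, [MFK94] pp. 124–125; [SGA1] III Prop. 5.1; [Oort1971 §2]): the obstruction to lifting
`f₀ = μ₀ ≫ G : Z₀ = A₀.X ×_{A⧸J} A₀.X → X` across the square-zero thickening `i : Z₀ → Z = X ×_A X` is a tuple of Čech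
classes of `𝒪` on the closed fibre `Z̄ = X̄ ×_k X̄` (★ `exists_cechCocycle`, coordinates in the free coframe of
`Ω¹_{A₀.X∕(A⧸J)}` ★ `CotangentSheafFreeOverLocalRing` and a basis of `J`); along the two slices `X → X ×_A X` through a section
`ε` (which exists by smoothness, ★ `exists_lift_of_smooth_affine`) the lifting problem pulls back to «lift `G` along `G`»,
solved by `𝟙_X`, so the classes die on the slices (★ `cechCochain_char_comap`, ★ `cechCochain_mem_cechB1_of_lift`); by
KÜNNETH (★ `Motives.eq_zero_of_cechComapH1_pullback_slices_eq_zero`, fibres proper and geometrically integral) they vanish,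
i.e. are coboundaries, and ★ `exists_lift_of_cechCochain_mem_cechB1` glues the corrected local lifts.

HC_CM is proved only modulo the 7 printed citations until rung 0 closes; this file discharges none of them (it removes the
research half of F-4 `stub_IIa` ∕ F-11 (A4b) together with B-p04 (g22)'s FILE B).

## References
* [MumfordFogartyKirwan1994] D. Mumford, J. Fogarty, F. Kirwan, *Geometric Invariant Theory*, 3rd ed. (1994), Ch. 6 §3
  Prop. 6.15 (pp. 124–125).
* [SGA1] A. Grothendieck, M. Raynaud, *SGA 1*, LNM 224 / arXiv:math/0206203: Exp. III §5 Prop. 5.1, Cor. 5.2 (arXiv ed. p. 71).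
* [GortzWedhorn2023] U. Görtz, T. Wedhorn, *Algebraic Geometry II* (2023), Thm. 24.73 proof (p. 550), Cor. 22.110 (Künneth).
-/

noncomputable section

-- products in `Over (Spec A)` are `pullback`s only up to instance unfolding (as in ★ `AbelianSchemeLiftRigidity`).
set_option backward.isDefEq.respectTransparency false

open CategoryTheory CategoryTheory.Limits AlgebraicGeometry Opposite IsLocalRing MonoidalCategory CartesianMonoidalCategory
open scoped MonObj

namespace Literature.AlgebraicGeometry.AbelianSchemes.AbelianSchemeOver

open Literature.AlgebraicGeometry.Deformation Literature.AlgebraicGeometry.Morphisms Literature.AlgebraicGeometry.Motives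
  Literature.AlgebraicGeometry.HodgeTheory Literature.AlgebraicGeometry.AbelianSchemes.AbelianSchemeOver.LiftedLaw

/-! ### §1 Affine charts of the source adapted to the target; local lifts; a section -/

section Charts

variable {A : Type} [CommRing A] (J : Ideal A) {X : Over (Spec (.of A))}
  {A₀ : AbelianSchemeOver (Spec (.of (A ⧸ J)))} {G : A₀.X.left ⟶ X.left}
  {Z Z₀ : Scheme.{0}} {q : Z ⟶ Spec (.of A)} {q₀ : Z₀ ⟶ Spec (.of (A ⧸ J))} {i : Z₀ ⟶ Z}
  (hi : IsPullback i q₀ q (Spec.map (CommRingCat.ofHom (Ideal.Quotient.mk J))))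

include hi in
/-- **Affine charts of the thickening adapted to an open of the thin source**: for `z₀ ∈ W₀ ⊆ Z₀` open there is an
affine open `U ∋ i z₀` of `Z` with `i⁻¹U ⊆ W₀` (`i` is a surjective closed immersion, hence a homeomorphism).
[cite: SGA1, Exp. III §5 Prop. 5.1] -/
theorem exists_affineOpen_preimage_le [Surjective i] (W₀ : Z₀.Opens) (z₀ : Z₀) (hz : z₀ ∈ W₀) :
    ∃ U : Z.Opens, IsAffineOpen U ∧ i.base z₀ ∈ U ∧ i ⁻¹ᵁ U ≤ W₀ := by
  haveI : IsClosedImmersion i :=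
    MorphismProperty.of_isPullback hi.flip (IsClosedImmersion.spec_of_surjective _ Ideal.Quotient.mk_surjective)
  have hinj : Function.Injective i.base := i.isClosedEmbedding.injective
  have hcl : IsClosed (i.base '' (W₀ : Set Z₀)ᶜ) := i.isClosedEmbedding.isClosedMap _ W₀.2.isClosed_compl
  let O : Z.Opens := ⟨(i.base '' (W₀ : Set Z₀)ᶜ)ᶜ, hcl.isOpen_compl⟩
  have hzO : i.base z₀ ∈ O := by
    rintro ⟨w, hw, hwe⟩
    exact hw (hinj hwe ▸ hz)
  obtain ⟨U, hU, hzU, hUO⟩ := (TopologicalSpace.Opens.isBasis_iff_nbhd.mp Z.isBasis_affineOpens) hzO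
  refine ⟨U, hU, hzU, fun z hzU' => ?_⟩
  by_contra hzW
  exact hUO hzU' ⟨z, hzW, rfl⟩

include hi in
/-- **Local lifts of `f₀` on adapted charts** ([SGA1] III Cor. 5.2: `𝒫(f₀)` is locally non-empty for a smooth target): for an
affine `U ⊆ Z` with `i⁻¹U ⊆ f₀⁻¹V`, `V ⊆ X` affine, the restriction of `f₀` to `Spec Γ(Z₀, i⁻¹U)` lifts to an `S`-morphism
`g : Spec Γ(Z, U) → X` through `V` (★ `exists_lift_of_smooth_affine`). [cite: SGA1, Exp. III §5 Cor. 5.2] -/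
theorem exists_localLift [Smooth X.hom] (hJ2 : J * J = ⊥) (f₀ : Z₀ ⟶ X.left)
    (hf₀ : f₀ ≫ X.hom = q₀ ≫ Spec.map (CommRingCat.ofHom (Ideal.Quotient.mk J)))
    {U : Z.Opens} (hU : IsAffineOpen U) {V : X.left.Opens} (hV : IsAffineOpen V) (hUV : i ⁻¹ᵁ U ≤ f₀ ⁻¹ᵁ V) :
    ∃ (g : Spec (.of Γ(Z, U)) ⟶ X.left), g ⁻¹ᵁ V = ⊤ ∧ g ≫ X.hom = hU.fromSpec ≫ q ∧
      Spec.map (i.app U) ≫ g = (isAffineOpen_preimage_of_isPullback_mk J hi ⟨U, hU⟩).fromSpec ≫ f₀ := by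
  have hU₀ : IsAffineOpen (i ⁻¹ᵁ U) := isAffineOpen_preimage_of_isPullback_mk J hi ⟨U, hU⟩
  -- scalar structures
  letI algZ : Algebra A Γ(Z, U) := ((Z.presheaf.map (homOfLE (le_top : U ≤ ⊤)).op).hom.comp (specStructureMap q)).toAlgebra
  letI algZ₀ : Algebra A Γ(Z₀, i ⁻¹ᵁ U) :=
    (((Z₀.presheaf.map (homOfLE (le_top : i ⁻¹ᵁ U ≤ ⊤)).op).hom.comp (specStructureMap q₀)).comp
      (Ideal.Quotient.mk J)).toAlgebra
  -- `i♯` as an `A`-algebra map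
  let π : Γ(Z, U) →ₐ[A] Γ(Z₀, i ⁻¹ᵁ U) :=
    { (i.app U).hom with
      commutes' := fun a => app_specStructureMap_of_isPullback (Ideal.Quotient.mk J) hi U a }
  obtain ⟨hπs, hπk⟩ := app_surjective_and_ker_eq_of_isPullback_mk J hi ⟨U, hU⟩
  have hnil : IsNilpotent (RingHom.ker (π : Γ(Z, U) →+* Γ(Z₀, i ⁻¹ᵁ U))) := by
    refine ⟨2, ?_⟩
    change RingHom.ker (i.app U).hom ^ 2 = 0
    rw [ker_app_sq_eq_bot_of_isPullback_mk J hi hJ2 ⟨U, hU⟩]; rfl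
  -- the chart of `f₀` on `i⁻¹U`
  have halg₀ : CommRingCat.ofHom (algebraMap A Γ(Z₀, i ⁻¹ᵁ U)) =
      CommRingCat.ofHom (Ideal.Quotient.mk J) ≫ ((Scheme.ΓSpecIso (.of (A ⧸ J))).inv ≫ q₀.appLE ⊤ (i ⁻¹ᵁ U) le_top) := rfl
  have w₀ : (hU₀.fromSpec ≫ f₀) ≫ X.hom = Spec.map (CommRingCat.ofHom (algebraMap A Γ(Z₀, i ⁻¹ᵁ U))) := by
    rw [Category.assoc, hf₀, ← Category.assoc, fromSpec_comp_eq_specMap hU₀ q₀, ← Spec.map_comp, halg₀]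
  have hf₀V : (hU₀.fromSpec ≫ f₀) ⁻¹ᵁ V = ⊤ := by
    rw [Scheme.Hom.comp_preimage]
    apply top_le_iff.mp
    rw [← hU₀.fromSpec_preimage_self]
    exact Scheme.Hom.preimage_mono _ hUV
  obtain ⟨g, hg, w, h₀⟩ := exists_lift_of_smooth_affine X.hom π hV hπs hnil (hU₀.fromSpec ≫ f₀) w₀ hf₀V
  refine ⟨g, hg, ?_, h₀⟩
  rw [w]
  exact (fromSpec_comp_eq_specMap hU q).symm

end Charts

section Section

variable {A : Type} [CommRing A] [IsArtinianRing A] [IsLocalRing A] (J : Ideal A) {X : Over (Spec (.of A))}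
  {A₀ : AbelianSchemeOver (Spec (.of (A ⧸ J)))} {G : A₀.X.left ⟶ X.left}
  (hG : IsPullback G A₀.X.hom X.hom (Spec.map (CommRingCat.ofHom (Ideal.Quotient.mk J))))

include hG in
/-- **A section of the deformation through the identity section of `A₀`** ([SGA1] III Cor. 5.2 for the one-point scheme
`Spec A`: `X → Spec A` is smooth and `Spec (A⧸J) ↪ Spec A` is a nilpotent thickening, so `η ≫ G : Spec (A⧸J) → X` extends;
★ `exists_lift_of_smooth_affine` on an affine open around the image point). [cite: SGA1, Exp. III §5 Cor. 5.2] -/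
theorem exists_section_comp_eq [Smooth X.hom] (hJ : J ≠ ⊤) :
    ∃ ε : Spec (.of A) ⟶ X.left, ε ≫ X.hom = 𝟙 _ ∧
      Spec.map (CommRingCat.ofHom (Ideal.Quotient.mk J)) ≫ ε = η[A₀.X].left ≫ G := by
  haveI : Nontrivial (A ⧸ J) := Ideal.Quotient.nontrivial_iff.mpr hJ
  haveI : IsLocalRing (A ⧸ J) := IsLocalRing.of_surjective' (Ideal.Quotient.mk J) Ideal.Quotient.mk_surjective
  -- the point of `X` under the identity section, and an affine open around it
  let f₀ : Spec (.of (A ⧸ J)) ⟶ X.left := η[A₀.X].left ≫ G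
  let x₀ : ↥(Spec (.of (A ⧸ J))) := IsLocalRing.closedPoint (A ⧸ J)
  obtain ⟨V, hV, hxV, -⟩ := (TopologicalSpace.Opens.isBasis_iff_nbhd.mp X.left.isBasis_affineOpens)
    (show f₀.base x₀ ∈ (⊤ : X.left.Opens) from trivial)
  have hf₀V : f₀ ⁻¹ᵁ V = ⊤ := by
    haveI := subsingleton_spec (A := A ⧸ J)
    rcases opens_eq_bot_or_top (A := A ⧸ J) (f₀ ⁻¹ᵁ V) with h | h
    · exfalso
      have : x₀ ∈ f₀ ⁻¹ᵁ V := hxV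
      rw [h] at this
      exact this
    · exact h
  have w₀ : f₀ ≫ X.hom = Spec.map (CommRingCat.ofHom (algebraMap A (A ⧸ J))) := by
    change (η[A₀.X].left ≫ G) ≫ X.hom = _
    rw [Category.assoc, hG.w, ← Category.assoc, Over.w η[A₀.X]]
    change 𝟙 _ ≫ _ = _
    rw [Category.id_comp]
    exact congrArg (fun f : A →+* A ⧸ J => Spec.map (CommRingCat.ofHom f)) (RingHom.ext fun _ => rfl)
  have hnil : IsNilpotent (RingHom.ker ((Ideal.Quotient.mkₐ A J : A →ₐ[A] A ⧸ J) : A →+* A ⧸ J)) := by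
    change IsNilpotent (RingHom.ker (Ideal.Quotient.mk J))
    rw [Ideal.mk_ker]
    exact isNilpotent_of_ne_top hJ
  obtain ⟨ε, -, w, h⟩ := exists_lift_of_smooth_affine X.hom (Ideal.Quotient.mkₐ A J) hV
    Ideal.Quotient.mk_surjective hnil f₀ w₀ hf₀V
  refine ⟨ε, ?_, h⟩
  rw [w]
  change Spec.map (CommRingCat.ofHom (RingHom.id A)) = _
  rw [CommRingCat.ofHom_id, Spec.map_id]

end Section

/-! ### §2 Slices and fibres -/

section Slices

variable {A : Type} [CommRing A] (J : Ideal A) {X : Over (Spec (.of A))}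
  {A₀ : AbelianSchemeOver (Spec (.of (A ⧸ J)))} {G : A₀.X.left ⟶ X.left}
  (hG : IsPullback G A₀.X.hom X.hom (Spec.map (CommRingCat.ofHom (Ideal.Quotient.mk J))))
  {ε : Spec (.of A) ⟶ X.left} (hε₁ : ε ≫ X.hom = 𝟙 _)
  (hε : Spec.map (CommRingCat.ofHom (Ideal.Quotient.mk J)) ≫ ε = η[A₀.X].left ≫ G)

/-- Intersections of affine opens of a scheme separated over an affine base are affine (Mathlib's
`isAffineHom_diagonal_iff`). [cite: Hartshorne1977, Ch. II Ex. 4.3 (p. 106)] -/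
theorem isAffineOpen_inf_of_isSeparated {Y : Scheme.{0}} (f : Y ⟶ Spec (.of A)) [IsSeparated f] {U W : Y.Opens}
    (hU : IsAffineOpen U) (hW : IsAffineOpen W) : IsAffineOpen (U ⊓ W) :=
  isAffineHom_diagonal_iff.mp (inferInstance : IsAffineHom (pullback.diagonal f)) ⊤ (isAffineOpen_top _) U le_top W
    le_top hU hW

include hG hε₁ hε in
/-- **The right slice through the section**: `s = (ρ_X)⁻¹ ≫ X ◁ ε : X → X ×_A X` restricts, on `A₀.X`, to the slice
`s₀ = (ρ)⁻¹ ≫ A₀.X ◁ η` through the identity: `s₀ ≫ i = G ≫ s` for the thickening `i = G ×_{mk} G`.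
[cite: MumfordFogartyKirwan1994, Ch. 6 §3 Prop. 6.15 proof (pp. 124–125)] -/
theorem whiskerLeft_slice_comp :
    ((ρ_ A₀.X).inv ≫ A₀.X ◁ η[A₀.X]).left ≫
        pullback.map A₀.X.hom A₀.X.hom X.hom X.hom G G (Spec.map (CommRingCat.ofHom (Ideal.Quotient.mk J)))
          hG.w.symm hG.w.symm =
      G ≫ ((ρ_ X).inv ≫ X ◁ (Over.homMk ε hε₁ : 𝟙_ (Over (Spec (.of A))) ⟶ X)).left := by
  apply pullback.hom_ext <;> simp [reassoc_of% hG.w, hε]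

include hG hε₁ hε in
/-- **The left slice through the section**: `(λ_X)⁻¹ ≫ ε ▷ X` restricts on `A₀.X` to `(λ)⁻¹ ≫ η ▷ A₀.X`.
[cite: MumfordFogartyKirwan1994, Ch. 6 §3 Prop. 6.15 proof (pp. 124–125)] -/
theorem whiskerRight_slice_comp :
    ((λ_ A₀.X).inv ≫ η[A₀.X] ▷ A₀.X).left ≫
        pullback.map A₀.X.hom A₀.X.hom X.hom X.hom G G (Spec.map (CommRingCat.ofHom (Ideal.Quotient.mk J)))
          hG.w.symm hG.w.symm =
      G ≫ ((λ_ X).inv ≫ (Over.homMk ε hε₁ : 𝟙_ (Over (Spec (.of A))) ⟶ X) ▷ X).left := by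
  apply pullback.hom_ext <;> simp [reassoc_of% hG.w, hε]

include hG in
/-- **The closed fibre of the deformation is the closed fibre of `A₀`**, hence geometrically integral
(★ `geometricallyIntegral_hom_overBase`): `X ×_A k = A₀.X ×_{A⧸J} k` for `A → A⧸J → k` (`J ⊆ 𝔪`).
[cite: MumfordFogartyKirwan1994, Ch. 6 §3 Prop. 6.15 proof (pp. 124–125)] -/
theorem geometricallyIntegral_pullback_snd_residue [IsLocalRing A] (hJle : J ≤ maximalIdeal A) :
    GeometricallyIntegral (pullback.snd X.hom (Spec.map (CommRingCat.ofHom (algebraMap A (ResidueField A))))) := by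
  set σ := Spec.map (CommRingCat.ofHom (algebraMap A (ResidueField A))) with hσ
  let τ : A ⧸ J →+* ResidueField A :=
    Ideal.Quotient.lift J (residue A) fun a ha => (IsLocalRing.residue_eq_zero_iff a).mpr (hJle ha)
  let σ₀ : Spec (.of (ResidueField A)) ⟶ Spec (.of (A ⧸ J)) := Spec.map (CommRingCat.ofHom τ)
  have hτ : CommRingCat.ofHom (algebraMap A (ResidueField A)) =
      CommRingCat.ofHom (Ideal.Quotient.mk J) ≫ CommRingCat.ofHom τ := by
    ext a; rfl
  have hfac : σ = σ₀ ≫ Spec.map (CommRingCat.ofHom (Ideal.Quotient.mk J)) := by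
    rw [hσ, hτ, Spec.map_comp]
  have hP := IsPullback.of_hasPullback X.hom σ
  have w : pullback.fst X.hom σ ≫ X.hom = (pullback.snd X.hom σ ≫ σ₀) ≫
      Spec.map (CommRingCat.ofHom (Ideal.Quotient.mk J)) := by
    rw [Category.assoc, ← hfac]; exact hP.w
  have h' : IsPullback (hG.lift (pullback.fst X.hom σ) (pullback.snd X.hom σ ≫ σ₀) w ≫ G) (pullback.snd X.hom σ) X.hom
      (σ₀ ≫ Spec.map (CommRingCat.ofHom (Ideal.Quotient.mk J))) := by
    rw [IsPullback.lift_fst, ← hfac]; exact hP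
  have hsq : IsPullback (hG.lift (pullback.fst X.hom σ) (pullback.snd X.hom σ ≫ σ₀) w) (pullback.snd X.hom σ) A₀.X.hom σ₀ :=
    IsPullback.of_right h' (hG.lift_snd _ _ w) hG
  exact MorphismProperty.of_isPullback hsq A₀.geometricallyIntegral_hom_overBase

end Slices

/-! ### §3 The theorem -/

section Main

variable (A : Type) [CommRing A] [IsArtinianRing A] [IsLocalRing A] (J : Ideal A)

/-- **[MFK94] Prop. 6.15, lifting half (F-4 `stub_IIaE` ∕ F-11 (A4b) FILE A (E)): the group law of an abelian scheme lifts, as a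
morphism, to any smooth proper deformation over a square-zero thickening `Spec (A⧸J) ↪ Spec A`, `𝔪·J = 0`, of an Artin local
base.**  With `X ×_A X` the cartesian-monoidal product in `Over (Spec A)` and `i = G ×_{mk} G` the thickening of
`A₀.X × A₀.X`, there is `m : X ⊗ X → X` with `μ₀ ≫ G = i ≫ m`.  Proof: module docstring (obstruction classes in `Ȟ¹` of the
closed fibre `X̄ × X̄`, killed on the two slices through a section, hence zero by Künneth).
[cite: MumfordFogartyKirwan1994, Ch. 6 §3 Prop. 6.15 (pp. 124–125)] [cite: SGA1, Exp. III §5 Prop. 5.1] -/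
theorem exists_mul_lift_of_isPullback_specMap_mk (hJ : J ≠ ⊤) (hmJ : maximalIdeal A * J = ⊥)
    (X : Over (Spec (.of A))) [IsProper X.hom] [Smooth X.hom]
    (A₀ : AbelianSchemeOver (Spec (.of (A ⧸ J)))) (G : A₀.X.left ⟶ X.left)
    (hG : IsPullback G A₀.X.hom X.hom (Spec.map (CommRingCat.ofHom (Ideal.Quotient.mk J)))) :
    ∃ m : X ⊗ X ⟶ X, μ[A₀.X].left ≫ G =
      pullback.map A₀.X.hom A₀.X.hom X.hom X.hom G G (Spec.map (CommRingCat.ofHom (Ideal.Quotient.mk J)))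
        hG.w.symm hG.w.symm ≫ m.left := by
  classical
  -- ## the base: a minimal basis of `J`, square zero
  have hJle : J ≤ maximalIdeal A := IsLocalRing.le_maximalIdeal hJ
  have hJ2 : J * J = ⊥ := mul_self_eq_bot_of_le_maximalIdeal J hmJ hJle
  obtain ⟨r, j, hj, hspan, hind⟩ := exists_generators_independent_mod_maximalIdeal (IsNoetherian.noetherian J) hmJ
  haveI : Nontrivial (A ⧸ J) := Ideal.Quotient.nontrivial_iff.mpr hJ
  haveI : IsLocalRing (A ⧸ J) := IsLocalRing.of_surjective' (Ideal.Quotient.mk J) Ideal.Quotient.mk_surjective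
  -- ## the coframe of `Ω¹_{A₀.X ∕ (A⧸J)}`
  haveI : ConnectedSpace ↥(Spec (CommRingCat.of (A ⧸ J))) := by
    haveI := subsingleton_spec (A := A ⧸ J)
    exact connectedSpace_iff_univ.mpr ⟨⟨IsLocalRing.closedPoint (A ⧸ J), trivial⟩,
      Set.subsingleton_of_subsingleton.isPreconnected⟩
  obtain ⟨n, hn⟩ := A₀.exists_isOfRelDim
  obtain ⟨Φ⟩ := A₀.nonempty_cotangentSheaf_iso_free_of_isLocalRing hn
  obtain ⟨e⟩ := Motives.nonempty_free_iso_over_of_iso_free Φ ⊤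
  -- ## source, thickening, law, fibre
  have hi := isPullback_tensor hG hG
  set ii := pullback.map A₀.X.hom A₀.X.hom X.hom X.hom G G (Spec.map (CommRingCat.ofHom (Ideal.Quotient.mk J)))
    hG.w.symm hG.w.symm with hii
  set f₀ : (A₀.X ⊗ A₀.X).left ⟶ X.left := μ[A₀.X].left ≫ G with hf₀
  have hf₀S : f₀ ≫ X.hom = (A₀.X ⊗ A₀.X).hom ≫ Spec.map (CommRingCat.ofHom (Ideal.Quotient.mk J)) := by
    rw [hf₀, Category.assoc, hG.w, ← Category.assoc, Over.w μ[A₀.X]]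
  let σ : Spec (.of (ResidueField A)) ⟶ Spec (.of A) := Spec.map (CommRingCat.ofHom (algebraMap A (ResidueField A)))
  have hpr : IsPullback (pullback.fst (X ⊗ X).hom σ) (pullback.snd (X ⊗ X).hom σ) (X ⊗ X).hom
      (Spec.map (CommRingCat.ofHom (residue A))) := IsPullback.of_hasPullback _ _
  let fZb : ((Over.pullback σ).obj (X ⊗ X)).left ⟶ Spec (.of A) := restrictBase A ((Over.pullback σ).obj (X ⊗ X)).hom
  haveI : Flat (X ⊗ X).hom := by rw [Over.tensorObj_hom]; infer_instance
  haveI : IsSeparated (X ⊗ X).hom := by rw [Over.tensorObj_hom]; infer_instance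
  haveI : Surjective (Spec.map (CommRingCat.ofHom (Ideal.Quotient.mk J))) := surjective_specMap_mk hJ
  haveI : Surjective ii := surjective_of_isPullback (Y₀ := A₀.X ⊗ A₀.X) (Y := X ⊗ X) hi
  -- ## the cover: affine charts of `X ×_A X` at the points of `A₀.X × A₀.X`, adapted to affine charts of `X`
  have cov : ∀ z₀ : ↥(A₀.X ⊗ A₀.X).left, ∃ (U : (X ⊗ X).left.Opens) (V : X.left.Opens),
      IsAffineOpen U ∧ IsAffineOpen V ∧ ii.base z₀ ∈ U ∧ ii ⁻¹ᵁ U ≤ f₀ ⁻¹ᵁ V := by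
    intro z₀
    obtain ⟨V, hV, hzV, -⟩ := (TopologicalSpace.Opens.isBasis_iff_nbhd.mp X.left.isBasis_affineOpens)
      (show f₀.base z₀ ∈ (⊤ : X.left.Opens) from trivial)
    obtain ⟨U, hU, hzU, hUV⟩ := exists_affineOpen_preimage_le J hi (f₀ ⁻¹ᵁ V) z₀ hzV
    exact ⟨U, V, hU, hV, hzU, hUV⟩
  choose U V hU hV hzU hUV using cov
  have hU₂ : ∀ α β, IsAffineOpen (U α ⊓ U β) := fun α β => isAffineOpen_inf_of_isSeparated (X ⊗ X).hom (hU α) (hU β)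
  have hU₃ : ∀ α β γ, IsAffineOpen (U α ⊓ U β ⊓ U γ) := fun α β γ =>
    isAffineOpen_inf_of_isSeparated (X ⊗ X).hom (hU₂ α β) (hU γ)
  have hV₂ : ∀ α β, IsAffineOpen (V α ⊓ V β) := fun α β => isAffineOpen_inf_of_isSeparated X.hom (hV α) (hV β)
  have hV₃ : ∀ α β γ, IsAffineOpen (V α ⊓ V β ⊓ V γ) := fun α β γ =>
    isAffineOpen_inf_of_isSeparated X.hom (hV₂ α β) (hV γ)
  have hcov : ⨆ z₀, U z₀ = ⊤ := by
    refine top_le_iff.mp fun z _ => ?_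
    obtain ⟨z₀, rfl⟩ := ii.surjective z
    exact TopologicalSpace.Opens.mem_iSup.mpr ⟨z₀, hzU z₀⟩
  let Ub : ↥(A₀.X ⊗ A₀.X).left → ((Over.pullback σ).obj (X ⊗ X)).left.Opens :=
    preimageFamily (pullback.fst (X ⊗ X).hom σ) U
  have hUb : ∀ α, Ub α = pullback.fst (X ⊗ X).hom σ ⁻¹ᵁ U α := fun _ => rfl
  -- ## local lifts
  have lifts := fun z₀ => exists_localLift J hi hJ2 f₀ hf₀S (hU z₀) (hV z₀) (hUV z₀)
  choose g hgV wg h₀g using lifts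
  -- ## T1: the obstruction cocycles
  obtain ⟨c, hcZ, hc⟩ := exists_cechCocycle J j X.hom hG e (X ⊗ X).hom hi hpr fZb f₀ U V Ub hU hU₂ hU₃ hV₂ hV₃ hUb
    g wg hgV h₀g hj hspan hind hmJ hJle
  -- ## the section and the slices
  obtain ⟨ε, hε₁, hε⟩ := exists_section_comp_eq J hG hJ
  let εo : 𝟙_ (Over (Spec (CommRingCat.of A))) ⟶ X := Over.homMk ε hε₁
  -- ## the classes die on a slice `s : X → X ×_A X` that restricts to a slice `s₀` of `A₀.X` with `s₀ ≫ μ₀ = 𝟙`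
  have key : ∀ (s : X ⟶ X ⊗ X) (s₀ : A₀.X ⟶ A₀.X ⊗ A₀.X), IsClosedImmersion s.left → s₀.left ≫ ii = G ≫ s.left →
      s₀ ≫ μ[A₀.X] = 𝟙 _ →
      ∀ ρ t, cechComapH1 fZb (restrictBase A ((Over.pullback σ).obj X).hom) ((Over.pullback σ).map s).left
        (pullback_map_left_comp_restrictBase σ s rfl rfl) Ub (CechH1.mk fZb Ub ⟨c ρ t, hcZ ρ t⟩) = 0 := by
    intro s s₀ hcl hss hs₀ ρ t
    haveI := hcl
    -- the fibre square of `Z' = X` and the pulled-back structure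
    have hpr' : IsPullback (pullback.fst X.hom σ) (pullback.snd X.hom σ) X.hom
        (Spec.map (CommRingCat.ofHom (residue A))) := IsPullback.of_hasPullback _ _
    have hs : s.left ≫ (X ⊗ X).hom = X.hom := Over.w s
    have hsqm : pullback.fst X.hom σ ≫ s.left = ((Over.pullback σ).map s).left ≫ pullback.fst (X ⊗ X).hom σ := by
      simp only [Over.pullback_map_left]
      erw [pullback.lift_fst]
    have hsbf : ((Over.pullback σ).map s).left ≫ fZb = restrictBase A ((Over.pullback σ).obj X).hom :=
      pullback_map_left_comp_restrictBase σ s rfl rfl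
    -- the pulled-back cover
    have hU' : ∀ α, IsAffineOpen (s.left ⁻¹ᵁ U α) := fun α => (hU α).preimage s.left
    have hU'₂ : ∀ α β, IsAffineOpen (s.left ⁻¹ᵁ U α ⊓ s.left ⁻¹ᵁ U β) := fun α β => (hU₂ α β).preimage s.left
    have hUb' := preimage_eq_preimage_preimage (pr := pullback.fst (X ⊗ X).hom σ) s.left
      ((Over.pullback σ).map s).left hsqm U Ub hUb
    -- the pulled-back lifts: `S`-morphisms, landing, and reduction «lift `G` along `G`»
    have w' : ∀ α, (Spec.map (s.left.app (U α)) ≫ g α) ≫ X.hom = (hU' α).fromSpec ≫ X.hom := by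
      intro α
      rw [Category.assoc, wg, ← Category.assoc, Scheme.Hom.app_eq_appLE,
        IsAffineOpen.SpecMap_appLE_fromSpec s.left (hU α) (hU' α), Category.assoc, hs]
    have hg' : ∀ α, (Spec.map (s.left.app (U α)) ≫ g α) ⁻¹ᵁ V α = ⊤ := by
      intro α
      rw [Scheme.Hom.comp_preimage, hgV, Scheme.Hom.preimage_top]
    have h₀' : ∀ α, Spec.map (G.app (s.left ⁻¹ᵁ U α)) ≫ (Spec.map (s.left.app (U α)) ≫ g α) =
        (isAffineOpen_preimage_of_isPullback_mk J hG ⟨s.left ⁻¹ᵁ U α, hU' α⟩).fromSpec ≫ G := by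
      intro α
      have hpre : G ⁻¹ᵁ (s.left ⁻¹ᵁ U α) = s₀.left ⁻¹ᵁ (ii ⁻¹ᵁ U α) := by
        rw [← Scheme.Hom.comp_preimage, ← Scheme.Hom.comp_preimage, hss]
      have hsq : Spec.map (G.app (s.left ⁻¹ᵁ U α)) ≫ Spec.map (s.left.app (U α)) =
          Spec.map (s₀.left.appLE (ii ⁻¹ᵁ U α) (G ⁻¹ᵁ (s.left ⁻¹ᵁ U α)) hpre.le) ≫ Spec.map (ii.app (U α)) := by
        rw [← Spec.map_comp, ← Spec.map_comp]
        congr 1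
        rw [Scheme.Hom.app_eq_appLE, Scheme.Hom.app_eq_appLE, Scheme.Hom.appLE_comp_appLE, Scheme.Hom.app_eq_appLE,
          Scheme.Hom.appLE_comp_appLE]
        have : ∀ (m₁ m₂ : A₀.X.left ⟶ (X ⊗ X).left) (_ : m₁ = m₂) (e₁ : G ⁻¹ᵁ (s.left ⁻¹ᵁ U α) ≤ m₁ ⁻¹ᵁ U α)
            (e₂ : G ⁻¹ᵁ (s.left ⁻¹ᵁ U α) ≤ m₂ ⁻¹ᵁ U α), m₁.appLE (U α) _ e₁ = m₂.appLE (U α) _ e₂ := by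
          rintro _ _ rfl _ _; rfl
        exact this _ _ hss.symm _ _
      rw [← Category.assoc, hsq, Category.assoc, h₀g α, ← Category.assoc,
        IsAffineOpen.SpecMap_appLE_fromSpec s₀.left (isAffineOpen_preimage_of_isPullback_mk J hi ⟨U α, hU α⟩)
          (isAffineOpen_preimage_of_isPullback_mk J hG ⟨s.left ⁻¹ᵁ U α, hU' α⟩) hpre.le,
        Category.assoc, hf₀, ← Category.assoc s₀.left, ← Over.comp_left, hs₀, Over.id_left, Category.id_comp]
    -- T4: the characteristic identities pull back along the slice
    have hc' := cechCochain_char_comap J j X.hom hG e (X ⊗ X).hom hi hpr fZb X.hom hpr'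
      (restrictBase A ((Over.pullback σ).obj X).hom) s.left hs ((Over.pullback σ).map s).left hsqm hsbf f₀ U V Ub hU
      hU₂ hU'₂ hV₂ hUb g wg hgV h₀g hspan hind hmJ hJle c hc
    -- T3: on `X` the problem «lift `G` along `G`» is solved by `𝟙_X`, so the pulled-back cochains are coboundaries
    have hB' := cechCochain_mem_cechB1_of_lift J j X.hom hG e X.hom hG hpr' (restrictBase A ((Over.pullback σ).obj X).hom)
      G (fun α => s.left ⁻¹ᵁ U α) V (fun α => ((Over.pullback σ).map s).left ⁻¹ᵁ Ub α) hU' hU'₂ hV hV₂ hUb'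
      (fun α => Spec.map (s.left.app (U α)) ≫ g α) w' hg' h₀' hj hspan hind hmJ hJle
      (fun ρ t => cechComapC1 fZb (restrictBase A ((Over.pullback σ).obj X).hom) ((Over.pullback σ).map s).left hsbf Ub
        (c ρ t)) hc' (𝟙 _) (Category.id_comp _) (Category.comp_id _) ρ t
    exact (cechComapH1_mk_eq_zero_iff fZb (restrictBase A ((Over.pullback σ).obj X).hom) ((Over.pullback σ).map s).left
      hsbf Ub ⟨c ρ t, hcZ ρ t⟩).mpr hB'
  -- ## Künneth: the classes vanish
  haveI : IsProper ((Over.pullback σ).obj X).hom := by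
    change IsProper (pullback.snd X.hom σ); infer_instance
  haveI : GeometricallyIntegral ((Over.pullback σ).obj X).hom := by
    change GeometricallyIntegral (pullback.snd X.hom σ); exact geometricallyIntegral_pullback_snd_residue J hG hJle
  have hB : ∀ ρ t, c ρ t ∈ cechB1 fZb Ub := fun ρ t =>
    (CechH1.mk_eq_zero_iff fZb Ub ⟨c ρ t, hcZ ρ t⟩).mp
      (eq_zero_of_cechComapH1_pullback_slices_eq_zero X X εo εo U hU hcov rfl rfl rfl _
        (key _ ((λ_ A₀.X).inv ≫ η[A₀.X] ▷ A₀.X)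
          (by
            have h : ((λ_ X).inv ≫ εo ▷ X).left ≫ pullback.snd X.hom X.hom = 𝟙 _ := by simp [εo]
            have : IsClosedImmersion (((λ_ X).inv ≫ εo ▷ X).left ≫ pullback.snd X.hom X.hom) := by
              rw [h]; infer_instance
            exact IsClosedImmersion.of_comp _ (pullback.snd X.hom X.hom))
          (whiskerRight_slice_comp J hG hε₁ hε) (by rw [Category.assoc, MonObj.one_mul, Iso.inv_hom_id]) ρ t)
        (key _ ((ρ_ A₀.X).inv ≫ A₀.X ◁ η[A₀.X])
          (by
            have h : ((ρ_ X).inv ≫ X ◁ εo).left ≫ pullback.fst X.hom X.hom = 𝟙 _ := by simp [εo]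
            have : IsClosedImmersion (((ρ_ X).inv ≫ X ◁ εo).left ≫ pullback.fst X.hom X.hom) := by
              rw [h]; infer_instance
            exact IsClosedImmersion.of_comp _ (pullback.fst X.hom X.hom))
          (whiskerLeft_slice_comp J hG hε₁ hε) (by rw [Category.assoc, MonObj.mul_one, Iso.inv_hom_id]) ρ t))
  -- ## T2: glue
  obtain ⟨Gl, wGl, hGl⟩ := exists_lift_of_cechCochain_mem_cechB1 J j X.hom hG e (X ⊗ X).hom hi hpr fZb f₀ U V Ub hU hU₂
    hcov hV hV₂ hUb g wg hgV h₀g hj hspan hind hmJ hJle c hc hB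
  exact ⟨Over.homMk Gl wGl, hGl.symm⟩

end Main

end Literature.AlgebraicGeometry.AbelianSchemes.AbelianSchemeOver

end
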